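import Summits.QuantumFields.YangMills.Theorems.UnitScaleTiltProp7TrueLinLineBound
import Summits.QuantumFields.YangMills.Theorems.UnitScaleTiltProp7LineOfTransportedFamily
import Summits.QuantumFields.YangMills.Theorems.UnitScaleTiltProp7TrueLinReducedStep
import Summits.QuantumFields.YangMills.Theorems.UnitScaleTiltProp7CovHodgeConstraint
import Literature.MathematicalPhysics.QuantumFieldTheory.Balaban1983to89.BlockAveragingTowerStraightTransportLocal
import HarnessLib

/-!
# Route `UnitScaleTilt`, crux K1 child «MinimiserStabilityRegPr» (stmt-QuantumFields-19200), line «route-R», growth side — PIECE (ii) OF THE THREE-PIECE SPLIT ON THE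
# LATTICE: A LEG LETTER AND ITS `Le_μ`-TRANSLATE, COMPARED BY STRAIGHT-LINE TRANSPORT, DIFFER BY `L` LONGITUDINAL COVARIANT DIFFERENCES OF THE SAME COMPONENT
# (`‖Y(x,ν) − Ad_{U₀([x → Le_μ])}Y(x+Le_μ, ν)‖ ≤ Σ_{t<L}‖(D_{U₀,μ}Y_ν)(x+te_μ)‖`), AND TWO TRANSPORTS BETWEEN THE SAME ENDPOINTS DIFFER BY ONE CLOSED-LOOP CONJUGATION

Cell `ym3-torus`, twin width seat `ym-routeR-w1` (g3); row (w1-o1′) NAMED by the route-R lead `ym-ust-19200-p1` (g13, bus 2026-08-28T13:33:15Z, piece (ii)).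
THEOREMS ONLY (0 `def`, 0 `sorry`); `--supports stmt-QuantumFields-19200 --as helper`, count-neutral.  Sequel of `…Prop7WordCommutatorSplit` (abstract split, pieces
(ii): ✓ `norm_commSum_sub_commSum_le`, `norm_comm_sub_le` charge `C(F) − C(F′)` and `[ΣF, ΣF′ − ΣF]` by MASS × `Σ_i‖F_i − F′_i‖`) and `…Prop7WordCommutatorSplitWalk`
(piece (i)).  YM₃ on T³ is a ladder rung (R3), not the Clay problem; nothing here claims stub S, row E′, the crux or the gap.

WHY.  In the symmetric (0.4) word `F·S·F′⁻¹` the backward legs `F′` are the `Le_μ`-TRANSLATE of forward legs (same ordering, in the `Idx`-mean), so piece (ii) needs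
`‖F_i − F′_i‖` for a leg letter `F_i = Ad_{U₀(Γ_{<i})}Y(b_i)` (based at the block centre `y`) and the translate letter read in the same frame.  Comparing along the
STRAIGHT LINE `[b_i₋ → b_i₋ + Le_μ]` the difference telescopes into `L` consecutive differences of the transported family `t ↦ Ad_{U₀([x → te_μ])}Y(x + te_μ, ν)` — and
consecutive members of that family differ by the transported LONGITUDINAL covariant difference `(D_{U₀,μ}Y_ν)(x + te_μ) = U₀(x_t,μ)·Y(x_{t+1}, ν)·U₀(x_t,μ)^* − Y(x_t, ν)`
of the SAME component `ν` ([Balaban1985BackgroundPropagators] (3.3)): GRADIENT letters, no corner term (the corners of the leg appear identically in `F` and `F′`).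
The loop word transports the translate letter to `y` along the staple `Γ_{<i}⁻¹ · axis · Γ′_{<i}` rather than along the straight line; two transports between the same
endpoints differ by ONE conjugation by the closed-loop holonomy `h` (`‖X − Ad_h X‖ ≤ 2‖h − 1‖·‖X‖` — the curved-word term, smallness of `h − 1` is the consumer's
small-field input, not estimated here).

WHAT IS PROVED (ns `…Theorems.Prop7WordCommutatorSplitTranslate`; any level `j`, `SU(N)` background `U₀`, bond field `Y`, transport direction `μ`, component `ν`;
`hol_t := ↑(holAt U₀ (walk x (replicate t (μ,true))))`, `x_t := shift_μ^t x`).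
* §1 ★★ `transLetter_succ_sub` — `hol_{t+1}·Y(x_{t+1},ν)·hol_{t+1}^* − hol_t·Y(x_t,ν)·hol_t^* = hol_t·(U₀(x_t,μ)·Y(x_{t+1},ν)·U₀(x_t,μ)^* − Y(x_t,ν))·hol_t^*` EXACT;
  `norm_transLetter_succ_sub_le`; `transLetter_sub_head_eq_sum` (telescoping); ★★ `norm_sub_transported_translate_le`
  (`‖Y(x,ν) − hol_m·Y(x_m,ν)·hol_m^*‖ ≤ Σ_{t<m}‖(D_{U₀,μ}Y_ν)(x_t)‖`); `sq_norm_sub_transported_translate_le` (Cauchy–Schwarz, `≤ m·Σ_{t<m}‖D_{U₀,μ}Y_ν‖²`).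
* §2 `conj_sub_conj_eq` (`Ad_{g₁}X − Ad_{g₂}X = Ad_{g₂}(Ad_{g₂^*g₁}X − X)`), ★ `norm_conj_sub_conj_le` (`≤ 2‖g₂^*g₁ − 1‖·‖X‖`, via ✓ `Prop7TrueLinReducedStep.norm_sub_conj_le`).
* §3 `transDiff_eq_covD` — dictionary: `U₀(x,μ)·Y(x+e_μ,ν)·U₀(x,μ)^* − Y(x,ν) = covD (torusT P j) (unitsField (toUField U₀)) μ (Y_ν) x` (✓ `Prop7CovHodgeConstraint.covD_bg_apply`),
  so §1's right-hand sides are the `(μ, ν)` entries of the covariant gradient form of ✓ `Prop7CovariantWeitzenbock.sum_covD_sq_le_curl_sq_add_divB_sq`.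
HONEST SCOPE.  Exact identities, the triangle inequality and Cauchy–Schwarz; the comb multiplicity count of the legs and the smallness of closed-loop holonomies are
the consumer's (✓ `Prop7TrueLinDefectBound` counts; (6)∕(14) plaquette smallness).

References: T. Bałaban, CMP 109 (1987) 249–301 [Balaban1987RG1] ((0.3)–(0.4) pp.252–253); CMP 99 (1985) 389–434 [Balaban1985BackgroundPropagators] ((3.3) p.390,
(3.43) p.398); CMP 98 (1985) 17–51 [Balaban1985Averaging] ((56)–(58) p.27).
-/

noncomputable section

open scoped BigOperators Matrix.Norms.L2Operator

namespace Summit.QuantumFields.YangMills.Theorems.Prop7WordCommutatorSplitTranslate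

open Literature.MathematicalPhysics.QuantumFieldTheory.Balaban1983to89
open Finset T4Continuum BlockAveraging AveragingRT ExpMeanLog BlockAveragingEMLLinearised BlockAveragingEMLLinearisedBackground BlockAveragingEMLProp2
open BlockAveragingTowerStraightTransportLocal (holAt_walk_replicate_true_add holAt_walk_replicate_true_one)
open Summit.QuantumFields.YangMills.Theorems.Prop7HolRatioPerStep (norm_coe_eq_one norm_star_coe_eq_one coe_star_mul_self coe_mul_star_self)

variable {P : Params} {n : Type*} [Fintype n] [DecidableEq n] [Nonempty n] {j : ℕ}

/-! ## §1 The transported translate family `t ↦ Ad_{U₀([x → te_μ])}Y(x + te_μ, ν)` and its telescoping -/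

/-- ★★ **CONSECUTIVE MEMBERS DIFFER BY THE TRANSPORTED LONGITUDINAL COVARIANT DIFFERENCE OF THE SAME COMPONENT** (exact):
`hol_{t+1}·Y(x_{t+1},ν)·hol_{t+1}^* − hol_t·Y(x_t,ν)·hol_t^* = hol_t·(U₀(x_t,μ)·Y(x_{t+1},ν)·U₀(x_t,μ)^* − Y(x_t,ν))·hol_t^*`. [cite: Balaban1985BackgroundPropagators, (3.3) p.390] -/
theorem transLetter_succ_sub (U₀ : GaugeField P j (Matrix.specialUnitaryGroup n ℂ)) (Y : PBond P j → Matrix n n ℂ) (x : Site P j) (μ ν : Fin P.d) (t : ℕ) :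
    ((holAt U₀ (walk x (List.replicate (t + 1) (μ, true))) : Matrix.specialUnitaryGroup n ℂ) : Matrix n n ℂ)
        * Y ⟨(fun z : Site P j => z.shift μ)^[t + 1] x, ν⟩
        * star ((holAt U₀ (walk x (List.replicate (t + 1) (μ, true))) : Matrix.specialUnitaryGroup n ℂ) : Matrix n n ℂ)
      - ((holAt U₀ (walk x (List.replicate t (μ, true))) : Matrix.specialUnitaryGroup n ℂ) : Matrix n n ℂ)
        * Y ⟨(fun z : Site P j => z.shift μ)^[t] x, ν⟩
        * star ((holAt U₀ (walk x (List.replicate t (μ, true))) : Matrix.specialUnitaryGroup n ℂ) : Matrix n n ℂ)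
      = ((holAt U₀ (walk x (List.replicate t (μ, true))) : Matrix.specialUnitaryGroup n ℂ) : Matrix n n ℂ)
        * (((U₀ ⟨(fun z : Site P j => z.shift μ)^[t] x, μ⟩ : Matrix.specialUnitaryGroup n ℂ) : Matrix n n ℂ)
              * Y ⟨((fun z : Site P j => z.shift μ)^[t] x).shift μ, ν⟩
              * star (((U₀ ⟨(fun z : Site P j => z.shift μ)^[t] x, μ⟩ : Matrix.specialUnitaryGroup n ℂ) : Matrix n n ℂ))
            - Y ⟨(fun z : Site P j => z.shift μ)^[t] x, ν⟩)
        * star ((holAt U₀ (walk x (List.replicate t (μ, true))) : Matrix.specialUnitaryGroup n ℂ) : Matrix n n ℂ) := by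
  rw [holAt_walk_replicate_true_add, holAt_walk_replicate_true_one, Submonoid.coe_mul, star_mul, Function.iterate_succ_apply']
  noncomm_ring

/-- `‖hol_{t+1}·Y(x_{t+1},ν)·hol_{t+1}^* − hol_t·Y(x_t,ν)·hol_t^*‖ ≤ ‖U₀(x_t,μ)·Y(x_{t+1},ν)·U₀(x_t,μ)^* − Y(x_t,ν)‖` (isometric conjugation).
[cite: Balaban1985BackgroundPropagators, (3.3) p.390] -/
theorem norm_transLetter_succ_sub_le (U₀ : GaugeField P j (Matrix.specialUnitaryGroup n ℂ)) (Y : PBond P j → Matrix n n ℂ) (x : Site P j) (μ ν : Fin P.d)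
    (t : ℕ) :
    ‖((holAt U₀ (walk x (List.replicate (t + 1) (μ, true))) : Matrix.specialUnitaryGroup n ℂ) : Matrix n n ℂ)
        * Y ⟨(fun z : Site P j => z.shift μ)^[t + 1] x, ν⟩
        * star ((holAt U₀ (walk x (List.replicate (t + 1) (μ, true))) : Matrix.specialUnitaryGroup n ℂ) : Matrix n n ℂ)
      - ((holAt U₀ (walk x (List.replicate t (μ, true))) : Matrix.specialUnitaryGroup n ℂ) : Matrix n n ℂ)
        * Y ⟨(fun z : Site P j => z.shift μ)^[t] x, ν⟩
        * star ((holAt U₀ (walk x (List.replicate t (μ, true))) : Matrix.specialUnitaryGroup n ℂ) : Matrix n n ℂ)‖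
      ≤ ‖((U₀ ⟨(fun z : Site P j => z.shift μ)^[t] x, μ⟩ : Matrix.specialUnitaryGroup n ℂ) : Matrix n n ℂ)
            * Y ⟨((fun z : Site P j => z.shift μ)^[t] x).shift μ, ν⟩
            * star (((U₀ ⟨(fun z : Site P j => z.shift μ)^[t] x, μ⟩ : Matrix.specialUnitaryGroup n ℂ) : Matrix n n ℂ))
          - Y ⟨(fun z : Site P j => z.shift μ)^[t] x, ν⟩‖ := by
  rw [transLetter_succ_sub]
  calc _ ≤ ‖((holAt U₀ (walk x (List.replicate t (μ, true))) : Matrix.specialUnitaryGroup n ℂ) : Matrix n n ℂ)‖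
        * ‖((U₀ ⟨(fun z : Site P j => z.shift μ)^[t] x, μ⟩ : Matrix.specialUnitaryGroup n ℂ) : Matrix n n ℂ)
              * Y ⟨((fun z : Site P j => z.shift μ)^[t] x).shift μ, ν⟩
              * star (((U₀ ⟨(fun z : Site P j => z.shift μ)^[t] x, μ⟩ : Matrix.specialUnitaryGroup n ℂ) : Matrix n n ℂ))
            - Y ⟨(fun z : Site P j => z.shift μ)^[t] x, ν⟩‖
        * ‖star ((holAt U₀ (walk x (List.replicate t (μ, true))) : Matrix.specialUnitaryGroup n ℂ) : Matrix n n ℂ)‖ :=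
        (norm_mul_le _ _).trans (mul_le_mul_of_nonneg_right (norm_mul_le _ _) (norm_nonneg _))
    _ = _ := by rw [norm_coe_eq_one, norm_star_coe_eq_one, one_mul, mul_one]

/-- **TELESCOPING**: `hol_m·Y(x_m,ν)·hol_m^* − Y(x,ν) = Σ_{t<m}(hol_{t+1}·Y(x_{t+1},ν)·hol_{t+1}^* − hol_t·Y(x_t,ν)·hol_t^*)`. [folklore] -/
theorem transLetter_sub_head_eq_sum (U₀ : GaugeField P j (Matrix.specialUnitaryGroup n ℂ)) (Y : PBond P j → Matrix n n ℂ) (x : Site P j) (μ ν : Fin P.d)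
    (m : ℕ) :
    ((holAt U₀ (walk x (List.replicate m (μ, true))) : Matrix.specialUnitaryGroup n ℂ) : Matrix n n ℂ)
        * Y ⟨(fun z : Site P j => z.shift μ)^[m] x, ν⟩
        * star ((holAt U₀ (walk x (List.replicate m (μ, true))) : Matrix.specialUnitaryGroup n ℂ) : Matrix n n ℂ)
      - Y ⟨x, ν⟩
      = ∑ t ∈ Finset.range m,
          (((holAt U₀ (walk x (List.replicate (t + 1) (μ, true))) : Matrix.specialUnitaryGroup n ℂ) : Matrix n n ℂ)
              * Y ⟨(fun z : Site P j => z.shift μ)^[t + 1] x, ν⟩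
              * star ((holAt U₀ (walk x (List.replicate (t + 1) (μ, true))) : Matrix.specialUnitaryGroup n ℂ) : Matrix n n ℂ)
            - ((holAt U₀ (walk x (List.replicate t (μ, true))) : Matrix.specialUnitaryGroup n ℂ) : Matrix n n ℂ)
              * Y ⟨(fun z : Site P j => z.shift μ)^[t] x, ν⟩
              * star ((holAt U₀ (walk x (List.replicate t (μ, true))) : Matrix.specialUnitaryGroup n ℂ) : Matrix n n ℂ)) := by
  rw [Finset.sum_range_sub (fun t => ((holAt U₀ (walk x (List.replicate t (μ, true))) : Matrix.specialUnitaryGroup n ℂ) : Matrix n n ℂ)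
        * Y ⟨(fun z : Site P j => z.shift μ)^[t] x, ν⟩
        * star ((holAt U₀ (walk x (List.replicate t (μ, true))) : Matrix.specialUnitaryGroup n ℂ) : Matrix n n ℂ))]
  have h0 : ((holAt U₀ (walk x (List.replicate 0 (μ, true))) : Matrix.specialUnitaryGroup n ℂ) : Matrix n n ℂ) = 1 := by
    simp [walk, holAt_nil]
  rw [h0, star_one, one_mul, mul_one, Function.iterate_zero_apply]

/-- ★★ **A LETTER AND ITS STRAIGHT-LINE-TRANSPORTED TRANSLATE DIFFER BY `m` LONGITUDINAL COVARIANT DIFFERENCES OF THE SAME COMPONENT**: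
`‖Y(x,ν) − U₀([x → me_μ])·Y(x + me_μ, ν)·U₀([x → me_μ])^*‖ ≤ Σ_{t<m}‖U₀(x_t,μ)·Y(x_{t+1},ν)·U₀(x_t,μ)^* − Y(x_t,ν)‖` — gradient letters only (the corners of a
staircase leg appear identically in the leg and in its translate and never enter). [cite: Balaban1985BackgroundPropagators, (3.3) p.390, (3.43) p.398] -/
theorem norm_sub_transported_translate_le (U₀ : GaugeField P j (Matrix.specialUnitaryGroup n ℂ)) (Y : PBond P j → Matrix n n ℂ) (x : Site P j) (μ ν : Fin P.d)
    (m : ℕ) :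
    ‖Y ⟨x, ν⟩
        - ((holAt U₀ (walk x (List.replicate m (μ, true))) : Matrix.specialUnitaryGroup n ℂ) : Matrix n n ℂ)
          * Y ⟨(fun z : Site P j => z.shift μ)^[m] x, ν⟩
          * star ((holAt U₀ (walk x (List.replicate m (μ, true))) : Matrix.specialUnitaryGroup n ℂ) : Matrix n n ℂ)‖
      ≤ ∑ t ∈ Finset.range m,
          ‖((U₀ ⟨(fun z : Site P j => z.shift μ)^[t] x, μ⟩ : Matrix.specialUnitaryGroup n ℂ) : Matrix n n ℂ)
              * Y ⟨((fun z : Site P j => z.shift μ)^[t] x).shift μ, ν⟩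
              * star (((U₀ ⟨(fun z : Site P j => z.shift μ)^[t] x, μ⟩ : Matrix.specialUnitaryGroup n ℂ) : Matrix n n ℂ))
            - Y ⟨(fun z : Site P j => z.shift μ)^[t] x, ν⟩‖ := by
  rw [norm_sub_rev, transLetter_sub_head_eq_sum]
  exact (norm_sum_le _ _).trans (Finset.sum_le_sum fun t _ => norm_transLetter_succ_sub_le U₀ Y x μ ν t)

/-- Cauchy–Schwarz form: `‖Y(x,ν) − Ad_{U₀([x → me_μ])}Y(x + me_μ, ν)‖² ≤ m·Σ_{t<m}‖(D_{U₀,μ}Y_ν)(x_t)‖²`. [cite: Balaban1985BackgroundPropagators, (3.43) p.398] -/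
theorem sq_norm_sub_transported_translate_le (U₀ : GaugeField P j (Matrix.specialUnitaryGroup n ℂ)) (Y : PBond P j → Matrix n n ℂ) (x : Site P j)
    (μ ν : Fin P.d) (m : ℕ) :
    ‖Y ⟨x, ν⟩
        - ((holAt U₀ (walk x (List.replicate m (μ, true))) : Matrix.specialUnitaryGroup n ℂ) : Matrix n n ℂ)
          * Y ⟨(fun z : Site P j => z.shift μ)^[m] x, ν⟩
          * star ((holAt U₀ (walk x (List.replicate m (μ, true))) : Matrix.specialUnitaryGroup n ℂ) : Matrix n n ℂ)‖ ^ 2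
      ≤ (m : ℝ) * ∑ t ∈ Finset.range m,
          ‖((U₀ ⟨(fun z : Site P j => z.shift μ)^[t] x, μ⟩ : Matrix.specialUnitaryGroup n ℂ) : Matrix n n ℂ)
              * Y ⟨((fun z : Site P j => z.shift μ)^[t] x).shift μ, ν⟩
              * star (((U₀ ⟨(fun z : Site P j => z.shift μ)^[t] x, μ⟩ : Matrix.specialUnitaryGroup n ℂ) : Matrix n n ℂ))
            - Y ⟨(fun z : Site P j => z.shift μ)^[t] x, ν⟩‖ ^ 2 := by
  have h := norm_sub_transported_translate_le U₀ Y x μ ν m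
  have hcs := sq_sum_le_card_mul_sum_sq (s := Finset.range m)
    (f := fun t => ‖((U₀ ⟨(fun z : Site P j => z.shift μ)^[t] x, μ⟩ : Matrix.specialUnitaryGroup n ℂ) : Matrix n n ℂ)
              * Y ⟨((fun z : Site P j => z.shift μ)^[t] x).shift μ, ν⟩
              * star (((U₀ ⟨(fun z : Site P j => z.shift μ)^[t] x, μ⟩ : Matrix.specialUnitaryGroup n ℂ) : Matrix n n ℂ))
            - Y ⟨(fun z : Site P j => z.shift μ)^[t] x, ν⟩‖)
  rw [Finset.card_range] at hcs
  exact (pow_le_pow_left₀ (norm_nonneg _) h 2).trans hcs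

/-! ## §2 Two transports between the same endpoints differ by one closed-loop conjugation -/

omit [Nonempty n] in
/-- `Ad_{g₁}X − Ad_{g₂}X = Ad_{g₂}(Ad_{g₂^*g₁}X − X)` for `g₁, g₂ ∈ SU(N)` (`h = g₂^*g₁` is the holonomy of the closed loop `path₂⁻¹·path₁`). [folklore] -/
theorem conj_sub_conj_eq (g₁ g₂ : Matrix.specialUnitaryGroup n ℂ) (X : Matrix n n ℂ) :
    (g₁ : Matrix n n ℂ) * X * star (g₁ : Matrix n n ℂ) - (g₂ : Matrix n n ℂ) * X * star (g₂ : Matrix n n ℂ)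
      = (g₂ : Matrix n n ℂ)
          * ((star (g₂ : Matrix n n ℂ) * (g₁ : Matrix n n ℂ)) * X * star (star (g₂ : Matrix n n ℂ) * (g₁ : Matrix n n ℂ)) - X)
          * star (g₂ : Matrix n n ℂ) := by
  have h2 : (g₂ : Matrix n n ℂ) * star (g₂ : Matrix n n ℂ) = 1 := coe_mul_star_self g₂
  rw [star_mul, star_star]
  -- expand the right-hand side and contract `g₂ g₂^* = 1` twice
  have e : (g₂ : Matrix n n ℂ) * ((star (g₂ : Matrix n n ℂ) * (g₁ : Matrix n n ℂ)) * X * (star (g₁ : Matrix n n ℂ) * (g₂ : Matrix n n ℂ)) - X)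
        * star (g₂ : Matrix n n ℂ)
      = ((g₂ : Matrix n n ℂ) * star (g₂ : Matrix n n ℂ)) * ((g₁ : Matrix n n ℂ) * X * star (g₁ : Matrix n n ℂ)) * ((g₂ : Matrix n n ℂ) * star (g₂ : Matrix n n ℂ))
        - (g₂ : Matrix n n ℂ) * X * star (g₂ : Matrix n n ℂ) := by noncomm_ring
  rw [e, h2, one_mul, mul_one]

/-- ★ **TWO TRANSPORTS BETWEEN THE SAME ENDPOINTS**: `‖Ad_{g₁}X − Ad_{g₂}X‖ ≤ 2‖g₂^*g₁ − 1‖·‖X‖` — e.g. the staple `Γ_{<i}⁻¹·axis·Γ′_{<i}` of the loop word versus the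
straight line `[b₋ → b₋ + Le_μ]` of §1: the price is the holonomy of ONE closed loop times the mass of the letter. [cite: Balaban1985Variational, (14) p.280] -/
theorem norm_conj_sub_conj_le (g₁ g₂ : Matrix.specialUnitaryGroup n ℂ) (X : Matrix n n ℂ) :
    ‖(g₁ : Matrix n n ℂ) * X * star (g₁ : Matrix n n ℂ) - (g₂ : Matrix n n ℂ) * X * star (g₂ : Matrix n n ℂ)‖
      ≤ 2 * ‖star (g₂ : Matrix n n ℂ) * (g₁ : Matrix n n ℂ) - 1‖ * ‖X‖ := by
  rw [conj_sub_conj_eq]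
  have hsu : star (g₂ : Matrix n n ℂ) * (g₁ : Matrix n n ℂ) = (((g₂⁻¹ * g₁ : Matrix.specialUnitaryGroup n ℂ)) : Matrix n n ℂ) := by
    rw [Submonoid.coe_mul]; rfl
  calc _ ≤ ‖(g₂ : Matrix n n ℂ)‖ * ‖(star (g₂ : Matrix n n ℂ) * (g₁ : Matrix n n ℂ)) * X * star (star (g₂ : Matrix n n ℂ) * (g₁ : Matrix n n ℂ)) - X‖
        * ‖star (g₂ : Matrix n n ℂ)‖ := (norm_mul_le _ _).trans (mul_le_mul_of_nonneg_right (norm_mul_le _ _) (norm_nonneg _))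
    _ = ‖(star (g₂ : Matrix n n ℂ) * (g₁ : Matrix n n ℂ)) * X * star (star (g₂ : Matrix n n ℂ) * (g₁ : Matrix n n ℂ)) - X‖ := by
        rw [norm_coe_eq_one, norm_star_coe_eq_one, one_mul, mul_one]
    _ ≤ 2 * ‖star (g₂ : Matrix n n ℂ) * (g₁ : Matrix n n ℂ) - 1‖ * ‖X‖ := by
        rw [← norm_neg, neg_sub, hsu]
        exact Prop7TrueLinReducedStep.norm_sub_conj_le _ _

/-! ## §3 Dictionary: the letter is `covD` of [Balaban1985BackgroundPropagators] (3.3) in the tree's letters -/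

/-- **`U₀(x,μ)·Y(x + e_μ, ν)·U₀(x,μ)^* − Y(x,ν) = (D_{U₀,μ}Y_ν)(x)`** in the letters of ✓ `Prop7CovariantWeitzenbock` ∕ ✓ `B9Eq39Adjoint.covD` (background read through
`unitsField ∘ toUField`, ✓ `Prop7CovHodgeConstraint.covD_bg_apply`): §1's right-hand sides are the `(μ, ν)` entries of the covariant gradient form.
[cite: Balaban1985BackgroundPropagators, (3.3) p.390] -/
theorem transDiff_eq_covD {N : ℕ} [NeZero N] (U₀ : GaugeField P j (Matrix.specialUnitaryGroup (Fin N) ℂ)) (Y : PBond P j → Matrix (Fin N) (Fin N) ℂ)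
    (x : Site P j) (μ ν : Fin P.d) :
    ((U₀ ⟨x, μ⟩ : Matrix.specialUnitaryGroup (Fin N) ℂ) : Matrix (Fin N) (Fin N) ℂ) * Y ⟨x.shift μ, ν⟩
        * star ((U₀ ⟨x, μ⟩ : Matrix.specialUnitaryGroup (Fin N) ℂ) : Matrix (Fin N) (Fin N) ℂ) - Y ⟨x, ν⟩
      = B9Eq39Adjoint.covD (B9TorusCalculus.torusT P j) (fun κ z => B10Eq27TorusAxialLog.unitsField (B10Eq27TorusAxialLog.toUField U₀) ⟨z, κ⟩) μ
          (fun z => Y ⟨z, ν⟩) x :=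
  (Prop7CovHodgeConstraint.covD_bg_apply U₀ (fun z => Y ⟨z, ν⟩) ⟨x, μ⟩).symm

end Summit.QuantumFields.YangMills.Theorems.Prop7WordCommutatorSplitTranslate

end
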